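import Literature.MathematicalPhysics.QuantumFieldTheory.Balaban1983to89.B9Eq326DeltaABlockDecayTowerTwoBackgroundsLipschitz
import Literature.MathematicalPhysics.QuantumFieldTheory.Balaban1983to89.B9Eq369CurvFormConjugationTwoBackgrounds

/-!
# `Balaban1983to89.B9Eq326DeltaABlockDecayTowerTwoBackgroundsCurv` — T. Bałaban, *Propagators for lattice gauge theories in a background field*, Commun. Math.
# Phys. **99** (1985) 389–434 [Balaban1985BackgroundPropagators] (3.26) p. 395, (3.10) p. 392, (3.49) p. 399, (3.69) p. 404, (3.101) p. 414, Thm 3.4 p. 400,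
# (3.86) p. 407, Thm 3.11 p. 416: **THE BIG-BLOCK `L²` DECAY OF `G₁,k(V) − G₁,k(U)` WITH THE CONJUGATED `Δ′` LETTER `δ_K` DISCHARGED TOO** — the `δ_K`
# conjunct of `B9Eq326DeltaABlockDecayTowerTwoBackgroundsLipschitz.norm_block_G1k_sub_G1k_le_lipschitz`'s two-background bundle supplied, uniformly on
# the circle `‖κ‖ = r`, by ne9-leaf-04 g81's `B9Eq369CurvFormConjugationTwoBackgrounds.norm_conj_curvOp_sub_conj_curvOp_le_of_plaq` at the weights
# `e^{±κχ(b₋)}` (`θ := ℓη`): `δ_K := e^{2rℓη}·16d·C_τ·M_φ²·(|η|^d∕c₀)·‖η⁻¹‖²·(12(δη)ε + 3δ_p)`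

statement-level skeleton of published theorems with citation tags; proofs where landed; nothing here is a claim about the Yang–Mills mass gap

PDF held: `paper:balaban1985-cmp99-background-propagators` (journal page = PDF page + 388); (3.26) p. 395, (3.69) p. 404, (3.101) p. 414 read through the suppliers.

CITATION HEADER (lean-in-tree rule 2026-08-18).  Audit cell `pub-balaban`, sub-cell `t4`, NE9 crux team (2): LEAF PROVER 01 (`b2b-balaban-t4-ne9-formalise-leaf-01`
gen 88), I-13 of the N52 road (α) batch; CREDIT ne9-leaf-04 g81 (the `δ_K` letter AND the suggestion, journal W-3 l.64060: «take the `δ_K` plug once I-1 ✓,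
as a v1.1 or a corollary»).  WHY: after I-12 the block-decay constant still displays the three CONJUGATED two-background letters `δ_R`, `δ_Q`∕`δ_Q′`, `δ_K`;
`δ_K` is local (plaquette sums) and ne9-leaf-04's file conjugates its difference with NO window on `κ`, so it can be discharged uniformly on the circle;
`δ_R` (non-local `R_k`, (PDC)-type) and `δ_Q`∕`δ_Q′` (the `Q_k` ∕ `Q_k^*` pair between two backgrounds under the three weights) remain DISPLAYED (`hT2'`).

WHAT IS PROVED (sorry-free; 0 `def`; [folklore] composition BY NAME; nothing of [B9] asserted as printed).
* **`norm_block_G1k_sub_G1k_le_lipschitz_curv`** — I-12's theorem with the bundle reduced to `δ_R ∧ δ_Q ∧ δ_Q′` and `δ_K` replaced by the explicit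
  constant above, under ne9-leaf-04's extra binders: `‖X*‖ ≤ ‖X‖`, `‖τX‖ ≤ C_τ‖X‖`, plaquettes of `U` within `ε ≥ 0` of `1`, plaquette closeness
  `‖U(∂p) − V(∂p)‖ ≤ δ_p` (bond closeness `δη` is I-12's `hUV`).  On print's diagonal (`ε = αη²`-type window, `δ_p ∝ δη²`, `c₀ = η^d`) the letter is `η`-free
  — the reader's bookkeeping, not evaluated here.
MODEL ∕ DECLARED READINGS.  Those of I-12 and of `B9Eq369CurvFormConjugationTwoBackgrounds` (unit-bounded `U^{±1}`, `V^{±1}` follow from `U1`-membership).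
HONEST SCOPE.  [folklore] one bundle re-assembled (`⟨tR, tQ, tQ′, tK⟩`) with `tK` from the cited theorem at `S := e^{κM_χ}` (pointwise by
`equiv_exp_smul_apply_complex`); ONE route sub-step's bookkeeping; «NE9 ⇐ the named binders»; NE9 NOT PRINTED ∕ NOT PROVED; NOT summit progress (cell
pub-balaban: row NE9 WALLED ON A MODEL (O-NE9-1; #5 UNRULED); spine PROVED 0∕9; rung (B)+1 finite T⁴ — NOT infinite volume, NOT mass gap, NOT BetaPertH, NOT
Clay; HONEST DEPENDENCY: continuum YM on T⁴ ⇐ BetaPertH ∧ nine spine estimates (0/9 proved); BetaPertH ⇐ (D1) ∧ (D4) ∧ CAP+tail; G-an2-4 gates asym, D1 and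
NE2/3/4).  NEW file; nothing modified.  Net new unproved facts: 0.
-/

noncomputable section

open scoped InnerProductSpace ComplexConjugate BigOperators
open NormedSpace

namespace Literature.MathematicalPhysics.QuantumFieldTheory.Balaban1983to89.B9Eq326DeltaABlockDecayTowerTwoBackgroundsCurv

open B4Sect5Torus (TSite tdist)
open B9SectCLatticeCarrier (Bond bpos btgt)
open B9Eq311L2Pairing (WL2)
open B9Eq319QprimeTorus (blockCoord)
open B9Eq315QTower (towerP)
open B9Eq315QTorus (perCfg cornerSite)
open B7Prop1Explicit (Wcx boxVec)
open B9Eq316TowerFlatIsOneStep (siteCast siteCast_rfl towerP_eq_fineP_pow)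
open B7Prop1Explicit (U1)
open B11Eq103H1Complex (SiteL2K BondL2K covDivL2K)
open B9Eq310HessianOperator (adTransportW PlaqL2K curvOp)
open B9Eq310DeltaPrime (plaqHolU)
open B9Eq326OperatorTower (laplaceAk RofUk G1k QkW)
open B9Eq326DeltaABlockDecayTowerTwoBackgroundsLipschitz (norm_block_G1k_sub_G1k_le_lipschitz)
open B9Eq369CurvFormConjugationTwoBackgrounds (norm_conj_curvOp_sub_conj_curvOp_le_of_plaq)
open B9Eq3101ExpPointwiseMultiplier (equiv_exp_smul_apply_complex equiv_exp_smul_neg_apply_complex)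

variable {d : ℕ} {L : ℕ} [NeZero L] {m : Fin d → ℕ} [∀ i, NeZero (m i)] {n : ℕ}
  {𝔸 : Type*} [NormedRing 𝔸] [StarRing 𝔸] [NormedAlgebra ℂ 𝔸] [StarModule ℂ 𝔸] [CompleteSpace 𝔸] [NormOneClass 𝔸]
  {W : Type*} [NormedAddCommGroup W] [InnerProductSpace ℂ W] [FiniteDimensional ℂ W] (φ : W ≃ₗ[ℂ] 𝔸) {Mφ Mφ' : ℝ}
  (hφ : ∀ w, ‖φ w‖ ≤ Mφ * ‖w‖) (hφ' : ∀ X, ‖φ.symm X‖ ≤ Mφ' * ‖X‖) (hMφ : 0 ≤ Mφ) (hMφ' : 0 ≤ Mφ')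
  {c₀ : ℝ} [Fact (0 < c₀)] {c₁ : ℝ} [Fact (0 < c₁)] {η : ℝ} (hη : 0 < η) (hηL : η * (L : ℝ) ^ (n + 1) = 1)
  (U V : Bond d (towerP L m (n + 1)) → 𝔸ˣ) (hU : ∀ b, U b ∈ U1 𝔸) (hV : ∀ b, V b ∈ U1 𝔸)
  (hRSU : ∀ (b : Bond d (towerP L m (n + 1))) (v u : W), ⟪adTransportW φ U b v, u⟫_ℂ = ⟪v, adTransportW φ (fun b => (U b)⁻¹) b u⟫_ℂ)
  (hRSV : ∀ (b : Bond d (towerP L m (n + 1))) (v u : W), ⟪adTransportW φ V b v, u⟫_ℂ = ⟪v, adTransportW φ (fun b => (V b)⁻¹) b u⟫_ℂ)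
  (τ : 𝔸 →ₗ[ℂ] ℂ) (hL : 1 ≤ L) (α : ℕ → ℝ) (hα1 : ∀ j, α j ≤ 1 / 64)
  (hU1U : ∀ (j : ℕ) (x : B7Prop1Explicit.Site d) (κ : Fin d), perCfg (towerP L m (j + 1)) (B9Eq315QTower.UlevOf L m (n + 1) U j) x κ ∈ U1 𝔸)
  (hregU : ∀ (j : ℕ) (y : TSite d (towerP L m j)) (κ : Fin d) (r : Fin d → Fin L),
    ‖((Wcx L (perCfg (towerP L m (j + 1)) (B9Eq315QTower.UlevOf L m (n + 1) U j)) (cornerSite L y) κ (boxVec L r) : 𝔸ˣ) : 𝔸) - 1‖ ≤ α j)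
  (hU1V : ∀ (j : ℕ) (x : B7Prop1Explicit.Site d) (κ : Fin d), perCfg (towerP L m (j + 1)) (B9Eq315QTower.UlevOf L m (n + 1) V j) x κ ∈ U1 𝔸)
  (hregV : ∀ (j : ℕ) (y : TSite d (towerP L m j)) (κ : Fin d) (r : Fin d → Fin L),
    ‖((Wcx L (perCfg (towerP L m (j + 1)) (B9Eq315QTower.UlevOf L m (n + 1) V j)) (cornerSite L y) κ (boxVec L r) : 𝔸ˣ) : 𝔸) - 1‖ ≤ α j)
  (a : ℝ)

include hφ hφ' hMφ hMφ' hη hηL hU hV hRSU hRSV in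
/-- **THE BIG-BLOCK `L²` DECAY OF `G₁,k(V) − G₁,k(U)` WITH `e_R`, `e_Q` AND THE CONJUGATED `Δ′` LETTER DISCHARGED**:
`B9Eq326DeltaABlockDecayTowerTwoBackgroundsLipschitz.norm_block_G1k_sub_G1k_le_lipschitz` with its two-background bundle cut to `δ_R ∧ δ_Q ∧ δ_Q′` (`hT2'`)
and `δ_K := e^{2rℓη}·16d·C_τ·M_φ²·(|η|^d∕c₀)·‖η⁻¹‖²·(12(δη)ε + 3δ_p)` from ne9-leaf-04's `norm_conj_curvOp_sub_conj_curvOp_le_of_plaq` on the circle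
`‖κ‖ = r` at the weights `e^{±κχ(b₋)}`. Displayed: (CDT)'s letters twice, `δ_R`, `δ_Q`∕`δ_Q′`. [folklore]
[cite: Balaban1985BackgroundPropagators, (3.26) p.395, (3.10) p.392, (3.49) p.399, (3.69) p.404, (3.101) p.414, Thm 3.4 p.400, (3.86) p.407, Thm 3.11 p.416; Balaban1985Variational, (110) p.294] -/
theorem norm_block_G1k_sub_G1k_le_lipschitz_curv (ha : 0 ≤ a) (hm : ∀ i, 1 ≤ m i)
    (hposU : ∀ x : BondL2K ℂ d (towerP L m (n + 1)) c₀ W, x ≠ 0 → 0 < RCLike.re ⟪x, laplaceAk L m n φ η U hL α hα1 hU1U hregU τ (c₀ := c₀) (c₁ := c₁) a x⟫_ℂ)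
    (hposV : ∀ x : BondL2K ℂ d (towerP L m (n + 1)) c₀ W, x ≠ 0 → 0 < RCLike.re ⟪x, laplaceAk L m n φ η V hL α hα1 hU1V hregV τ (c₀ := c₀) (c₁ := c₁) a x⟫_ℂ)
    {γ β βK pK ℓ ℓ' r ρ CP : ℝ} (hγ : 0 < γ) (hβ : 0 ≤ β) (hℓ : 1 ≤ ℓ) (hℓ' : 1 ≤ ℓ') (hr : 0 ≤ r) (hρ : 0 ≤ ρ) (hρ8 : ρ ≤ 1 / 8)
    (hCP : 0 ≤ CP)
    (hcoerU : ∀ f : BondL2K ℂ d (towerP L m (n + 1)) c₀ W, γ * ‖f‖ ^ 2 ≤ RCLike.re ⟪f, laplaceAk L m n φ η U hL α hα1 hU1U hregU τ (c₀ := c₀) (c₁ := c₁) a f⟫_ℂ)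
    (hcoerV : ∀ f : BondL2K ℂ d (towerP L m (n + 1)) c₀ W, γ * ‖f‖ ^ 2 ≤ RCLike.re ⟪f, laplaceAk L m n φ η V hL α hα1 hU1V hregV τ (c₀ := c₀) (c₁ := c₁) a f⟫_ℂ)
    (hKreU : ∀ f : BondL2K ℂ d (towerP L m (n + 1)) c₀ W, -(pK * ‖f‖ ^ 2) ≤ RCLike.re ⟪f, curvOp φ τ η U f⟫_ℂ)
    (hKreV : ∀ f : BondL2K ℂ d (towerP L m (n + 1)) c₀ W, -(pK * ‖f‖ ^ 2) ≤ RCLike.re ⟪f, curvOp φ τ η V f⟫_ℂ)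
    (hwin : r * ℓ * η ≤ 1)
    (hβCC : 4 * r * ℓ * (Mφ * Mφ') * (d * Real.sqrt d) ≤ β) (hβC : 4 * r * ℓ * (Mφ * Mφ') * d ≤ β)
    (hβD : 2 * r * ℓ * (Mφ * Mφ') * Real.sqrt d ≤ β)
    (hQKU : ∀ (χ : TSite d (towerP L m (n + 1)) → ℝ) (χ' : TSite d m → ℝ),
      (∀ b : Bond d (towerP L m (n + 1)), |χ (bpos b) - χ (btgt b)| ≤ ℓ * η) →
      (∀ (y : TSite d m) (x : TSite d (towerP L m (n + 1))),
        siteCast (towerP_eq_fineP_pow L m (n + 1)) x ∈ B9Eq319QprimeTorus.blockOf (L ^ (n + 1)) m y → |χ' y - χ x| ≤ ℓ') →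
      ∀ (MB : BondL2K ℂ d (towerP L m (n + 1)) c₀ W →L[ℂ] BondL2K ℂ d (towerP L m (n + 1)) c₀ W),
      (∀ (g : BondL2K ℂ d (towerP L m (n + 1)) c₀ W) (b : Bond d (towerP L m (n + 1))),
        WL2.equiv ℂ (fun _ : Bond d (towerP L m (n + 1)) => c₀) W (MB g) b = (χ (bpos b) : ℂ) • WL2.equiv ℂ (fun _ : Bond d (towerP L m (n + 1)) => c₀) W g b) →
      ∀ (MS : SiteL2K ℂ d (towerP L m (n + 1)) c₀ W →L[ℂ] SiteL2K ℂ d (towerP L m (n + 1)) c₀ W),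
      (∀ (g : SiteL2K ℂ d (towerP L m (n + 1)) c₀ W) (x : TSite d (towerP L m (n + 1))),
        WL2.equiv ℂ (fun _ : TSite d (towerP L m (n + 1)) => c₀) W (MS g) x = (χ x : ℂ) • WL2.equiv ℂ (fun _ : TSite d (towerP L m (n + 1)) => c₀) W g x) →
      ∀ (MF : BondL2K ℂ d m c₁ W →L[ℂ] BondL2K ℂ d m c₁ W),
      (∀ (g : BondL2K ℂ d m c₁ W) (b' : Bond d m),
        WL2.equiv ℂ (fun _ : Bond d m => c₁) W (MF g) b' = (χ' (bpos b') : ℂ) • WL2.equiv ℂ (fun _ : Bond d m => c₁) W g b') →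
      ∀ κ : ℂ, ‖κ‖ = r →
      (∀ f, ‖exp (κ • MF) ((QkW L m n φ U hL α hα1 hU1U hregU (c₀ := c₀) (c₁ := c₁)) (exp (κ • (-MB)) f)) - (QkW L m n φ U hL α hα1 hU1U hregU (c₀ := c₀) (c₁ := c₁)) f‖ ≤ β * ‖f‖) ∧
      (∀ g, ‖exp (κ • MB) (LinearMap.adjoint (QkW L m n φ U hL α hα1 hU1U hregU (c₀ := c₀) (c₁ := c₁)) (exp (κ • (-MF)) g)) - LinearMap.adjoint (QkW L m n φ U hL α hα1 hU1U hregU (c₀ := c₀) (c₁ := c₁)) g‖ ≤ β * ‖g‖) ∧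
      (∀ f, ‖exp (κ • MB) (curvOp φ τ η U (exp (κ • (-MB)) f)) - curvOp φ τ η U f‖ ≤ βK * ‖f‖) ∧
      (∀ s, ‖exp (κ • MS) (RofUk L m n φ η U (c₀ := c₀) (exp (κ • (-MS)) s)) - RofUk L m n φ η U (c₀ := c₀) s‖ ≤ ρ * ‖s‖))
    (hQKV : ∀ (χ : TSite d (towerP L m (n + 1)) → ℝ) (χ' : TSite d m → ℝ),
      (∀ b : Bond d (towerP L m (n + 1)), |χ (bpos b) - χ (btgt b)| ≤ ℓ * η) →
      (∀ (y : TSite d m) (x : TSite d (towerP L m (n + 1))),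
        siteCast (towerP_eq_fineP_pow L m (n + 1)) x ∈ B9Eq319QprimeTorus.blockOf (L ^ (n + 1)) m y → |χ' y - χ x| ≤ ℓ') →
      ∀ (MB : BondL2K ℂ d (towerP L m (n + 1)) c₀ W →L[ℂ] BondL2K ℂ d (towerP L m (n + 1)) c₀ W),
      (∀ (g : BondL2K ℂ d (towerP L m (n + 1)) c₀ W) (b : Bond d (towerP L m (n + 1))),
        WL2.equiv ℂ (fun _ : Bond d (towerP L m (n + 1)) => c₀) W (MB g) b = (χ (bpos b) : ℂ) • WL2.equiv ℂ (fun _ : Bond d (towerP L m (n + 1)) => c₀) W g b) →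
      ∀ (MS : SiteL2K ℂ d (towerP L m (n + 1)) c₀ W →L[ℂ] SiteL2K ℂ d (towerP L m (n + 1)) c₀ W),
      (∀ (g : SiteL2K ℂ d (towerP L m (n + 1)) c₀ W) (x : TSite d (towerP L m (n + 1))),
        WL2.equiv ℂ (fun _ : TSite d (towerP L m (n + 1)) => c₀) W (MS g) x = (χ x : ℂ) • WL2.equiv ℂ (fun _ : TSite d (towerP L m (n + 1)) => c₀) W g x) →
      ∀ (MF : BondL2K ℂ d m c₁ W →L[ℂ] BondL2K ℂ d m c₁ W),
      (∀ (g : BondL2K ℂ d m c₁ W) (b' : Bond d m),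
        WL2.equiv ℂ (fun _ : Bond d m => c₁) W (MF g) b' = (χ' (bpos b') : ℂ) • WL2.equiv ℂ (fun _ : Bond d m => c₁) W g b') →
      ∀ κ : ℂ, ‖κ‖ = r →
      (∀ f, ‖exp (κ • MF) ((QkW L m n φ V hL α hα1 hU1V hregV (c₀ := c₀) (c₁ := c₁)) (exp (κ • (-MB)) f)) - (QkW L m n φ V hL α hα1 hU1V hregV (c₀ := c₀) (c₁ := c₁)) f‖ ≤ β * ‖f‖) ∧
      (∀ g, ‖exp (κ • MB) (LinearMap.adjoint (QkW L m n φ V hL α hα1 hU1V hregV (c₀ := c₀) (c₁ := c₁)) (exp (κ • (-MF)) g)) - LinearMap.adjoint (QkW L m n φ V hL α hα1 hU1V hregV (c₀ := c₀) (c₁ := c₁)) g‖ ≤ β * ‖g‖) ∧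
      (∀ f, ‖exp (κ • MB) (curvOp φ τ η V (exp (κ • (-MB)) f)) - curvOp φ τ η V f‖ ≤ βK * ‖f‖) ∧
      (∀ s, ‖exp (κ • MS) (RofUk L m n φ η V (c₀ := c₀) (exp (κ • (-MS)) s)) - RofUk L m n φ η V (c₀ := c₀) s‖ ≤ ρ * ‖s‖))
    (hPU : ∀ f, ‖covDivL2K ℂ c₀ ((η : ℂ))⁻¹ (adTransportW φ fun b => (U b)⁻¹) f - RofUk L m n φ η U (c₀ := c₀) (covDivL2K ℂ c₀ ((η : ℂ))⁻¹ (adTransportW φ fun b => (U b)⁻¹) f)‖ ≤ CP * ‖f‖)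
    (hPV : ∀ f, ‖covDivL2K ℂ c₀ ((η : ℂ))⁻¹ (adTransportW φ fun b => (V b)⁻¹) f - RofUk L m n φ η V (c₀ := c₀) (covDivL2K ℂ c₀ ((η : ℂ))⁻¹ (adTransportW φ fun b => (V b)⁻¹) f)‖ ≤ CP * ‖f‖)
    (small' : 3 / 4 * pK + (21 + 3 * a) * β ^ 2 + 4 * β * CP + 2 * ρ * CP ^ 2 + βK ≤ γ / 8)
    {δR δQ : ℝ} (hδR : 0 ≤ δR) (hδQ : 0 ≤ δQ)
    (hT2' : ∀ (χ : TSite d (towerP L m (n + 1)) → ℝ) (χ' : TSite d m → ℝ),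
      (∀ b : Bond d (towerP L m (n + 1)), |χ (bpos b) - χ (btgt b)| ≤ ℓ * η) →
      (∀ (y : TSite d m) (x : TSite d (towerP L m (n + 1))),
        siteCast (towerP_eq_fineP_pow L m (n + 1)) x ∈ B9Eq319QprimeTorus.blockOf (L ^ (n + 1)) m y → |χ' y - χ x| ≤ ℓ') →
      ∀ (MB : BondL2K ℂ d (towerP L m (n + 1)) c₀ W →L[ℂ] BondL2K ℂ d (towerP L m (n + 1)) c₀ W),
      (∀ (g : BondL2K ℂ d (towerP L m (n + 1)) c₀ W) (b : Bond d (towerP L m (n + 1))),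
        WL2.equiv ℂ (fun _ : Bond d (towerP L m (n + 1)) => c₀) W (MB g) b = (χ (bpos b) : ℂ) • WL2.equiv ℂ (fun _ : Bond d (towerP L m (n + 1)) => c₀) W g b) →
      ∀ (MS : SiteL2K ℂ d (towerP L m (n + 1)) c₀ W →L[ℂ] SiteL2K ℂ d (towerP L m (n + 1)) c₀ W),
      (∀ (g : SiteL2K ℂ d (towerP L m (n + 1)) c₀ W) (x : TSite d (towerP L m (n + 1))),
        WL2.equiv ℂ (fun _ : TSite d (towerP L m (n + 1)) => c₀) W (MS g) x = (χ x : ℂ) • WL2.equiv ℂ (fun _ : TSite d (towerP L m (n + 1)) => c₀) W g x) →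
      ∀ (MF : BondL2K ℂ d m c₁ W →L[ℂ] BondL2K ℂ d m c₁ W),
      (∀ (g : BondL2K ℂ d m c₁ W) (b' : Bond d m),
        WL2.equiv ℂ (fun _ : Bond d m => c₁) W (MF g) b' = (χ' (bpos b') : ℂ) • WL2.equiv ℂ (fun _ : Bond d m => c₁) W g b') →
      ∀ κ : ℂ, ‖κ‖ = r →
      (∀ s, ‖exp (κ • MS) (RofUk L m n φ η V (c₀ := c₀) (exp (κ • (-MS)) s)) - exp (κ • MS) (RofUk L m n φ η U (c₀ := c₀) (exp (κ • (-MS)) s))‖ ≤ δR * ‖s‖) ∧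
      (∀ f, ‖exp (κ • MF) ((QkW L m n φ V hL α hα1 hU1V hregV (c₀ := c₀) (c₁ := c₁)) (exp (κ • (-MB)) f)) - exp (κ • MF) ((QkW L m n φ U hL α hα1 hU1U hregU (c₀ := c₀) (c₁ := c₁)) (exp (κ • (-MB)) f))‖ ≤ δQ * ‖f‖) ∧
      (∀ g, ‖exp (κ • MB) (LinearMap.adjoint (QkW L m n φ V hL α hα1 hU1V hregV (c₀ := c₀) (c₁ := c₁)) (exp (κ • (-MF)) g)) - exp (κ • MB) (LinearMap.adjoint (QkW L m n φ U hL α hα1 hU1U hregU (c₀ := c₀) (c₁ := c₁)) (exp (κ • (-MF)) g))‖ ≤ δQ * ‖g‖))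
    -- the bond closeness of the two backgrounds, and the TREE's binders for the two Lipschitz letters `e_R`, `e_Q` (now DISCHARGED):
    {δ : ℝ} (hδ : 0 ≤ δ) (hUV : ∀ b, ‖(U b : 𝔸) - (V b : 𝔸)‖ ≤ δ * η)
    -- ne9-leaf-04 g81's binders for the conjugated `Δ′` letter (`B9Eq369CurvFormConjugationTwoBackgrounds` §4, two closeness letters): the involution
    -- and trace bounds, the plaquette window `ε` of `U`, the plaquette closeness `δ_p`
    (hstar : ∀ X : 𝔸, ‖star X‖ ≤ ‖X‖) {Cτ : ℝ} (hτ : ∀ X, ‖τ X‖ ≤ Cτ * ‖X‖) (hCτ : 0 ≤ Cτ)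
    {ε : ℝ} (hε : 0 ≤ ε) (hpl : ∀ p : B9SectCLatticeCarrier.Plaq d (towerP L m (n + 1)), ‖(plaqHolU U p : 𝔸) - 1‖ ≤ ε)
    {δp : ℝ} (hδp : 0 ≤ δp) (hpp : ∀ p : B9SectCLatticeCarrier.Plaq d (towerP L m (n + 1)), ‖(plaqHolU U p : 𝔸) - (plaqHolU V p : 𝔸)‖ ≤ δp)
    -- (3.16)'s weight relation, the bond smallness of both backgrounds, the common level profiles (`B9Eq325RLipschitzSqrtTowerTwoBackgroundsLinear`'s binders)
    (hw : c₀ * ((L : ℝ) ^ (n + 1)) ^ d = c₁) {a' : ℝ} (ha' : 0 < a') {αb : ℝ} (hαb : 0 ≤ αb)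
    (hUε : ∀ b, ‖(U b : 𝔸) - 1‖ ≤ αb * η) (hVε : ∀ b, ‖(V b : 𝔸) - 1‖ ≤ αb * η)
    (εU δUV : ℕ → ℝ) (hεU : ∀ j, 0 ≤ εU j) (hδUV : ∀ j, 0 ≤ δUV j)
    (hLεU : ∀ (j : ℕ) (b : Bond d (towerP L m (j + 1))), ‖(B9Eq315QTower.UlevOf L m (n + 1) U j b : 𝔸) - 1‖ ≤ εU j)
    (hLεV : ∀ (j : ℕ) (b : Bond d (towerP L m (j + 1))), ‖(B9Eq315QTower.UlevOf L m (n + 1) V j b : 𝔸) - 1‖ ≤ εU j)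
    (hLbU : ∀ (j : ℕ) (b : Bond d (towerP L m (j + 1))), B9Eq315QTower.UlevOf L m (n + 1) U j b ∈ U1 𝔸)
    (hLbV : ∀ (j : ℕ) (b : Bond d (towerP L m (j + 1))), B9Eq315QTower.UlevOf L m (n + 1) V j b ∈ U1 𝔸)
    (hLUV : ∀ (j : ℕ) (b : Bond d (towerP L m (j + 1))), ‖(B9Eq315QTower.UlevOf L m (n + 1) U j b : 𝔸) - (B9Eq315QTower.UlevOf L m (n + 1) V j b : 𝔸)‖ ≤ δUV j)
    {rp α₀ δ₀ : ℝ} (hrp0 : 0 ≤ rp) (hrp1 : rp < 1) (hαα₀ : αb ≤ α₀) (hδ₀ : 0 < δ₀)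
    (hεg : ∀ j < n + 1, εU j ≤ αb * rp ^ j) (hδg : ∀ j < n + 1, δUV j ≤ δ * rp ^ j)
    {sD sQ θb δbD γR θbG δbA sS sV s₂ sG₂ sA₂ : ℝ}
    (hsD : sD = Real.sqrt d * (2 * Mφ * Mφ'))
    (hsQ : sQ = 2 * (((d * (L - 1) : ℕ) : ℝ) * (2 * Mφ * Mφ') / (1 - rp)))
    (hθb : θb = sQ * α₀) (hδbD : δbD = sD * α₀)
    (hγRdef : γR = 1 / (2 + 2 / a') - (δbD + δbD ^ 2 + a' * θb * (2 * 1 + θb)))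
    (hθbG : θbG = 2 * δbD * (γR⁻¹ * (Real.sqrt γR)⁻¹) + (|a'| * θb * ((1 + θb) + 1)) * γR⁻¹ ^ 2)
    (hδbA : δbA = θbG * (1 + θb) + (2 + 2 / a') * θb)
    (hsS : sS = Real.sqrt (1 / (12 * (d : ℝ) * (6 / 5) ^ (d - 1) + a') ^ 2)) (hsV : sV = sS - δbA)
    (hs₂ : s₂ = 2 * Real.exp ((d * (L - 1) : ℕ) * (2 * Mφ * Mφ' * α₀ / (1 - rp))) *
      ((d * (L - 1) : ℕ) * (2 * Mφ * Mφ') * (1 + 2 * Mφ * Mφ' * α₀) ^ (d * (L - 1)) / (1 - rp)))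
    (hsG₂ : sG₂ = 2 * sD * (γR⁻¹ * (Real.sqrt γR)⁻¹) + (|a'| * s₂ * ((1 + θb) + (1 + θb))) * γR⁻¹ ^ 2)
    (hsA₂ : sA₂ = sG₂ * (1 + θb) + γR⁻¹ * s₂)
    (hc1 : ((d * (L - 1) : ℕ) : ℝ) * (2 * Mφ * Mφ') / (1 - rp) * α₀ ≤ 1) (hγR : 0 < γR) (hDγ : δbD ≤ 1 / (2 + 2 / a')) (hsV0 : 0 < sV)
    (hB : ((d * (L - 1) : ℕ) * (2 * Mφ * Mφ') * (1 + 2 * Mφ * Mφ' * α₀) ^ (d * (L - 1)) / (1 - rp)) * δ₀ ≤ 1) (hwinR : 2 * sA₂ * δ₀ ≤ sV)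
    -- `B9Eq315QTowerLipschitzL2TwoBackgroundsChain`'s extra binders (the `Q_k` letter)
    (hα128 : ∀ j, α j ≤ 1 / 128) (hδmax : ∀ j, δUV j ≤ 1 / (12288 * ((2 * (d * L) + L + L : ℕ) : ℝ)))
    (hwinQ : Real.sqrt ((L : ℝ) ^ d) * (Real.sqrt (2 * d) * (75497472 * ((d : ℝ) + 1) * ((2 * (d * L) + L + L : ℕ) : ℝ))) / (1 - rp) * δ ≤ 1)
    (PB : TSite d m → BondL2K ℂ d (towerP L m (n + 1)) c₀ W →L[ℂ] BondL2K ℂ d (towerP L m (n + 1)) c₀ W)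
    (hPB : ∀ (y : TSite d m) (f : BondL2K ℂ d (towerP L m (n + 1)) c₀ W) (b : Bond d (towerP L m (n + 1))),
      WL2.equiv ℂ (fun _ : Bond d (towerP L m (n + 1)) => c₀) W (PB y f) b =
        if blockCoord (L ^ (n + 1)) m (siteCast (towerP_eq_fineP_pow L m (n + 1)) (bpos b)) = y then
          WL2.equiv ℂ (fun _ : Bond d (towerP L m (n + 1)) => c₀) W f b else 0)
    (y₀ y₁ : TSite d m) :
    ‖PB y₁ ∘L (LinearMap.toContinuousLinearMap (G1k L m n φ η V hL α hα1 hU1V hregV τ (c₀ := c₀) (c₁ := c₁) hposV) - LinearMap.toContinuousLinearMap (G1k L m n φ η U hL α hα1 hU1U hregU τ (c₀ := c₀) (c₁ := c₁) hposU)) ∘L PB y₀‖ ≤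
      (((1 + β) * (4 * Real.exp (r * (ℓ * η)) * (Mφ * Mφ') * (d * Real.sqrt d) * δ) + (4 * Real.exp (r * (ℓ * η)) * (Mφ * Mφ') * (d * Real.sqrt d) * δ) * (1 + β) + (4 * Real.exp (r * (ℓ * η)) * (Mφ * Mφ') * (d * Real.sqrt d) * δ) * (4 * Real.exp (r * (ℓ * η)) * (Mφ * Mφ') * (d * Real.sqrt d) * δ)) +
          ((1 + CP + β) * ((1 + ρ) * (2 * Real.exp (r * (ℓ * η)) * (Mφ * Mφ') * Real.sqrt d * δ) + δR * (1 + CP + β)) + (2 * Real.exp (r * (ℓ * η)) * (Mφ * Mφ') * Real.sqrt d * δ) * ((1 + ρ) * (1 + CP + β)) +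
            (2 * Real.exp (r * (ℓ * η)) * (Mφ * Mφ') * Real.sqrt d * δ) * ((1 + ρ) * (2 * Real.exp (r * (ℓ * η)) * (Mφ * Mφ') * Real.sqrt d * δ) + δR * (1 + CP + β))) +
          (Real.exp (2 * (r * (ℓ * η))) * (16 * d * Cτ * Mφ ^ 2 * (|η| ^ d / c₀) * (‖((η : ℂ))⁻¹‖ ^ 2 * (12 * (δ * η) * ε + 3 * δp)))) + ((Real.sqrt a + |a| * β) * δQ + δQ * (Real.sqrt a + |a| * β) + |a| * (δQ * δQ))) / min (1 / 4) (γ / 8) *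
        ((1 + (8 * Real.sqrt d * (Mφ * Mφ') * δ + 2 * Mφ * Mφ' * δ * Real.sqrt d + (max (3 * sA₂ / sV) (2 / δ₀) * δ) * (1 + CP) + Real.sqrt a *
          (Mφ' * Mφ * Real.sqrt (c₁ / (c₀ * ((L : ℝ) ^ (n + 1)) ^ d)) * (2 * Real.exp (Real.sqrt ((L : ℝ) ^ d) * (Real.sqrt (2 * d) * (102 * (d + 1) ^ 2 * L)) * (αb / (1 - rp))) * (Real.sqrt ((L : ℝ) ^ d) * (Real.sqrt (2 * d) * (75497472 * ((d : ℝ) + 1) * ((2 * (d * L) + L + L : ℕ) : ℝ))) / (1 - rp) * δ))))) * (min (1 / 4) (γ / 8))⁻¹) * Real.exp r * Real.exp (-(r * tdist m y₀ y₁)) := by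
  refine norm_block_G1k_sub_G1k_le_lipschitz φ hφ hφ' hMφ hMφ' hη hηL U V hU hV hRSU hRSV τ hL α hα1 hU1U hregU hU1V hregV a
    ha hm hposU hposV hγ hβ hℓ hℓ' hr hρ hρ8 hCP hcoerU hcoerV hKreU hKreV hwin hβCC hβC hβD hQKU hQKV hPU hPV small' hδR hδQ ?hK0 ?hT2 hδ hUV hw ha' hαb hUε hVε εU δUV hεU hδUV hLεU hLεV hLbU hLbV hLUV hrp0 hrp1 hαα₀ hδ₀ hεg hδg hsD hsQ hθb hδbD hγRdef hθbG hδbA hsS hsV hs₂ hsG₂ hsA₂ hc1 hγR hDγ hsV0 hB hwinR hα128 hδmax hwinQ PB hPB y₀ y₁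
  · have hc₀ : (0 : ℝ) < c₀ := Fact.out
    positivity
  · intro χ χ' hχ hχ' MB hMB MS hMS MF hMF κ hκr
    obtain ⟨tR, tQ, tQ'⟩ := hT2' χ χ' hχ hχ' MB hMB MS hMS MF hMF κ hκr
    refine ⟨tR, tQ, tQ', fun f => ?_⟩
    have hUn : ∀ b : Bond d (towerP L m (n + 1)), ‖(U b : 𝔸)‖ ≤ 1 ∧ ‖(((U b)⁻¹ : 𝔸ˣ) : 𝔸)‖ ≤ 1 := fun b => B7Prop1Explicit.mem_U1.1 (hU b)
    have hVn : ∀ b : Bond d (towerP L m (n + 1)), ‖(V b : 𝔸)‖ ≤ 1 ∧ ‖(((V b)⁻¹ : 𝔸ˣ) : 𝔸)‖ ≤ 1 := fun b => B7Prop1Explicit.mem_U1.1 (hV b)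
    -- the weights `e^{±κχ(b₋)}` as linear maps, pointwise
    have hS : ∀ (g : BondL2K ℂ d (towerP L m (n + 1)) c₀ W) (b : Bond d (towerP L m (n + 1))),
        WL2.equiv ℂ (fun _ : Bond d (towerP L m (n + 1)) => c₀) W
            (((exp (κ • MB) : BondL2K ℂ d (towerP L m (n + 1)) c₀ W →L[ℂ] BondL2K ℂ d (towerP L m (n + 1)) c₀ W) :
              BondL2K ℂ d (towerP L m (n + 1)) c₀ W →ₗ[ℂ] BondL2K ℂ d (towerP L m (n + 1)) c₀ W) g) b =
          Complex.exp (κ * (χ (bpos b) : ℂ)) • WL2.equiv ℂ (fun _ : Bond d (towerP L m (n + 1)) => c₀) W g b :=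
      fun g b => equiv_exp_smul_apply_complex MB (fun b => χ (bpos b)) hMB κ g b
    have hSinv : ∀ (g : BondL2K ℂ d (towerP L m (n + 1)) c₀ W) (b : Bond d (towerP L m (n + 1))),
        WL2.equiv ℂ (fun _ : Bond d (towerP L m (n + 1)) => c₀) W
            (((exp (κ • (-MB)) : BondL2K ℂ d (towerP L m (n + 1)) c₀ W →L[ℂ] BondL2K ℂ d (towerP L m (n + 1)) c₀ W) :
              BondL2K ℂ d (towerP L m (n + 1)) c₀ W →ₗ[ℂ] BondL2K ℂ d (towerP L m (n + 1)) c₀ W) g) b =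
          Complex.exp (-(κ * (χ (bpos b) : ℂ))) • WL2.equiv ℂ (fun _ : Bond d (towerP L m (n + 1)) => c₀) W g b :=
      fun g b => equiv_exp_smul_neg_apply_complex MB (fun b => χ (bpos b)) hMB κ g b
    have h := norm_conj_curvOp_sub_conj_curvOp_le_of_plaq φ hφ hMφ hstar τ hτ hCτ η hUn hVn hpl (θ := ℓ * η) (by positivity) hχ hS hSinv
      (mul_nonneg hδ hη.le) hδp hε hUV hpp f
    rw [hκr] at h
    simpa only [LinearMap.comp_apply, ContinuousLinearMap.coe_coe] using h

end Literature.MathematicalPhysics.QuantumFieldTheory.Balaban1983to89.B9Eq326DeltaABlockDecayTowerTwoBackgroundsCurv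

end
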